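import Mathlib
import Literature.Analysis.FluidPDE.GaussianVortexPlanar
import Literature.Analysis.FluidPDE.GaussianVortexPlanarProofs
import Literature.Analysis.FluidPDE.BiotSavart2DSymmetry
import Summits.AnomalousDissipation.AnomalousDissipation.Theorems.MarginalStabilityChainStretchedVortexRowsStubCoreInverseTools
import Summits.AnomalousDissipation.AnomalousDissipation.Theorems.MarginalStabilityChainStretchedVortexRowsStubCoreRotationLocalSkew
import Summits.AnomalousDissipation.AnomalousDissipation.Theorems.MarginalStabilityChainStretchedVortexRowsStubWeakDivFreeGaussClass
import HarnessLib

/-!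
# Helper toward stub `stub_coreInverse` of the line `braid-closed-large-circulation-gluing`
# (crux stmt-AnomalousDissipation-3009, `MarginalStabilityChain.StretchedVortexRows`):
# the radial↔radial block of the background pairing vanishes

For a RADIAL `u₀ ∈ C¹` (bounded, with bounded derivative), its radial Gaussian multiple `w₀ = G u₀`, and a Gaussian-class
background density `w_B ∈ C¹`:
  `∫ u₀ ⟪K∗w₀, ∇w_B⟫ = 0`                                           (`lamB_radial_block_eq_zero`).
The velocity of a radial vorticity is azimuthal, `K∗w₀ = c(x) x^⊥` (tree `biotSavart2D_eq_smul_perp_of_radial`), while the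
gradient of a radial function is radial, `Du₀(x)[x^⊥] = 0` (landed `fderiv_perp_eq_zero_of_radial`); hence
`⟪K∗w₀, ∇u₀⟫ = 0` pointwise and `u₀⟪K∗w₀, ∇w_B⟫ = ⟪K∗w₀, ∇(u₀w_B)⟫`, whose integral vanishes by the weak divergence-freeness
of `K∗w₀` against the Gaussian-class test function `u₀ w_B` (`integral_inner_biotSavart2D_gradient_eq_zero_of_gaussClass`).
This is the structural zero that makes the background term `⟨Λ_B w, w⟩` of the energy method for `stub_coreInverse` controllable
by the angular energy alone (`lamB_pairing_w_bound`).
-/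

set_option linter.dupNamespace false

noncomputable section

open scoped RealInnerProductSpace Topology
open MeasureTheory WithLp Function Metric Filter Set

namespace Summit.AnomalousDissipation.AnomalousDissipation.Theorems.MarginalStabilityChainStretchedVortexRows

open Literature.Analysis.FluidPDE

/-- **The radial↔radial block of `⟨(K∗w)·∇w_B, G⁻¹w⟩` vanishes**: `∫ u₀ ⟪K∗(G u₀), ∇w_B⟫ = 0` for radial `u₀`. [folklore] -/
theorem lamB_radial_block_eq_zero :
    ∀ (k : ℕ) (C_B : ℝ) (wB u₀ : EuclideanSpace ℝ (Fin 2) → ℝ), ContDiff ℝ 1 wB →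
      (∀ ξ, |wB ξ| + ‖gradient wB ξ‖ ≤ C_B * (1 + ‖ξ‖) ^ k * gaussVortexProfile ξ) →
      ContDiff ℝ 1 u₀ → (∀ ξ η : EuclideanSpace ℝ (Fin 2), ‖ξ‖ = ‖η‖ → u₀ ξ = u₀ η) →
      (∃ M : ℝ, ∀ ξ, |u₀ ξ| ≤ M ∧ ‖fderiv ℝ u₀ ξ‖ ≤ M) →
      ∫ ξ, u₀ ξ * ⟪biotSavart2D (fun η => gaussVortexProfile η * u₀ η) ξ, gradient wB ξ⟫ = 0 := by
  intro k C_B wB u₀ hwB hwBb hu hrad hM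
  obtain ⟨M, hM⟩ := hM
  have hM0 : 0 ≤ M := (abs_nonneg _).trans (hM 0).1
  have hGpos : ∀ ξ : EuclideanSpace ℝ (Fin 2), 0 < gaussVortexProfile ξ := gaussVortexProfile_pos
  have hng : ∀ f : EuclideanSpace ℝ (Fin 2) → ℝ, ∀ x, ‖gradient f x‖ = ‖fderiv ℝ f x‖ := fun f x => by
    rw [gradient, LinearIsometryEquiv.norm_map]
  have hCB : 0 ≤ C_B := by
    have h0 := hwBb 0
    have hG0 := hGpos 0
    have : 0 ≤ |wB 0| + ‖gradient wB 0‖ := by positivity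
    simp only [norm_zero, add_zero, one_pow, mul_one] at h0
    nlinarith
  -- the radial vorticity `w₀ = G u₀`: continuous, bounded, integrable, invariant under linear isometries
  set w₀ : EuclideanSpace ℝ (Fin 2) → ℝ := fun η => gaussVortexProfile η * u₀ η with hw₀
  have hw₀c : Continuous w₀ := (contDiff_gaussVortexProfile (n := 0)).continuous.mul hu.continuous
  have hGle : ∀ η : EuclideanSpace ℝ (Fin 2), gaussVortexProfile η ≤ (4 * Real.pi)⁻¹ := fun η => by
    rw [gaussVortexProfile]
    have : Real.exp (-(‖η‖ ^ 2 / 4)) ≤ 1 := Real.exp_le_one_iff.2 (by nlinarith [sq_nonneg ‖η‖])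
    have hpi : 0 < (4 * Real.pi)⁻¹ := by positivity
    nlinarith
  have hw₀b : ∀ η, |w₀ η| ≤ (4 * Real.pi)⁻¹ * M := fun η => by
    show |gaussVortexProfile η * u₀ η| ≤ _
    rw [abs_mul, abs_of_pos (hGpos η)]
    exact mul_le_mul (hGle η) (hM η).1 (abs_nonneg _) (by positivity)
  have hw₀i : Integrable w₀ := by
    refine integrable_of_le_one_add_norm_pow_mul_gauss hw₀c (A := M) (N := 0) (fun η => ?_)
    rw [Real.norm_eq_abs, show |w₀ η| = |gaussVortexProfile η * u₀ η| from rfl, abs_mul, abs_of_pos (hGpos η),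
      pow_zero, one_mul, mul_comm]
    exact mul_le_mul_of_nonneg_right (hM η).1 (hGpos η).le
  have hw₀T : ∀ (T : EuclideanSpace ℝ (Fin 2) ≃ₗᵢ[ℝ] EuclideanSpace ℝ (Fin 2)) (y), w₀ (T y) = w₀ y := by
    intro T y
    show gaussVortexProfile (T y) * u₀ (T y) = gaussVortexProfile y * u₀ y
    rw [gaussVortexProfile, gaussVortexProfile, LinearIsometryEquiv.norm_map, hrad (T y) y (T.norm_map y)]
  set v : EuclideanSpace ℝ (Fin 2) → EuclideanSpace ℝ (Fin 2) := biotSavart2D w₀ with hv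
  -- `⟪v, ∇u₀⟫ = 0` pointwise: azimuthal velocity against a radial gradient
  have hvu : ∀ x, ⟪v x, gradient u₀ x⟫ = 0 := by
    intro x
    rw [inner_gradient_right]
    simp only [RCLike.conj_to_real]
    rw [hv, biotSavart2D_eq_smul_perp_of_radial hw₀T x, map_smul, fderiv_perp_eq_zero_of_radial hrad x, smul_zero]
  -- the Gaussian-class test function `h = u₀ w_B`
  set h : EuclideanSpace ℝ (Fin 2) → ℝ := fun η => u₀ η * wB η with hh
  have hh1 : ContDiff ℝ 1 h := hu.mul hwB
  have hud : ∀ x, DifferentiableAt ℝ u₀ x := fun x => hu.differentiable one_ne_zero x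
  have hwBd : ∀ x, DifferentiableAt ℝ wB x := fun x => hwB.differentiable one_ne_zero x
  have hhb : ∀ x, |h x| + ‖fderiv ℝ h x‖ ≤ 2 * M * C_B * (1 + ‖x‖) ^ k * gaussVortexProfile x := by
    intro x
    have hG := hGpos x
    have hb := hwBb x
    rw [hng] at hb
    have h1 : |h x| ≤ M * |wB x| := by
      show |u₀ x * wB x| ≤ _
      rw [abs_mul]
      exact mul_le_mul_of_nonneg_right (hM x).1 (abs_nonneg _)
    have h2 : ‖fderiv ℝ h x‖ ≤ M * ‖fderiv ℝ wB x‖ + |wB x| * M := by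
      rw [show h = fun η => u₀ η * wB η from rfl, fderiv_fun_mul (hud x) (hwBd x)]
      calc ‖u₀ x • fderiv ℝ wB x + wB x • fderiv ℝ u₀ x‖
          ≤ ‖u₀ x • fderiv ℝ wB x‖ + ‖wB x • fderiv ℝ u₀ x‖ := norm_add_le _ _
        _ = |u₀ x| * ‖fderiv ℝ wB x‖ + |wB x| * ‖fderiv ℝ u₀ x‖ := by
            rw [norm_smul, norm_smul, Real.norm_eq_abs, Real.norm_eq_abs]
        _ ≤ M * ‖fderiv ℝ wB x‖ + |wB x| * M := by
            gcongr
            · exact (hM x).1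
            · exact (hM x).2
    have hpos : 0 ≤ (1 + ‖x‖) ^ k * gaussVortexProfile x := by positivity
    calc |h x| + ‖fderiv ℝ h x‖ ≤ M * |wB x| + (M * ‖fderiv ℝ wB x‖ + |wB x| * M) := add_le_add h1 h2
      _ ≤ 2 * M * (|wB x| + ‖fderiv ℝ wB x‖) := by nlinarith [abs_nonneg (wB x), norm_nonneg (fderiv ℝ wB x)]
      _ ≤ 2 * M * (C_B * (1 + ‖x‖) ^ k * gaussVortexProfile x) := mul_le_mul_of_nonneg_left hb (by positivity)
      _ = 2 * M * C_B * (1 + ‖x‖) ^ k * gaussVortexProfile x := by ring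
  have hdiv : ∫ x, ⟪v x, gradient h x⟫ = 0 :=
    integral_inner_biotSavart2D_gradient_eq_zero_of_gaussClass k (2 * M * C_B) ((4 * Real.pi)⁻¹ * M) w₀ h hw₀c hw₀i
      hw₀b hh1 hhb
  -- pointwise `u₀ ⟪v, ∇w_B⟫ = ⟪v, ∇(u₀ w_B)⟫`
  have hpt : ∀ x, u₀ x * ⟪v x, gradient wB x⟫ = ⟪v x, gradient h x⟫ := by
    intro x
    have hvu' := hvu x
    rw [inner_gradient_right] at hvu'
    simp only [RCLike.conj_to_real] at hvu'
    rw [inner_gradient_right, inner_gradient_right]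
    simp only [RCLike.conj_to_real]
    rw [show h = fun η => u₀ η * wB η from rfl, fderiv_fun_mul (hud x) (hwBd x)]
    simp only [_root_.add_apply, _root_.smul_apply, smul_eq_mul, hvu', mul_zero, add_zero]
  calc ∫ ξ, u₀ ξ * ⟪v ξ, gradient wB ξ⟫ = ∫ ξ, ⟪v ξ, gradient h ξ⟫ :=
        integral_congr_ae (Eventually.of_forall hpt)
    _ = 0 := hdiv

end Summit.AnomalousDissipation.AnomalousDissipation.Theorems.MarginalStabilityChainStretchedVortexRows

end
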